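import Literature.NumberTheory.EllipticCurves.EichlerShimuraConstruction
import Literature.NumberTheory.EllipticCurves.NewformGaloisRep
import Literature.NumberTheory.EllipticCurves.NewformsCoeffFieldHolds
import Literature.NumberTheory.EllipticCurves.NewformsHeckeProofs
import HarnessLib

/-!
# The Eichler–Shimura construction: proved complements

Complements to `Literature/NumberTheory/EllipticCurves/EichlerShimuraConstruction.lean`, which
vendors `Literature.NumberTheory.EllipticCurves.ModularForms.eichlerShimuraConstruction` (Knapp 1993, Thm. 11.74 with Thm. 12.8;
Agashe–Ribet–Stein 2006, §2: a newform `f ∈ S₂(Γ₀(N))` with integer coefficients has a model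
`W/ℚ` of an elliptic curve with `aₙ(f) = aₙ(W)` for all `n` and `c Λ_f ⊆ Λ_E`) and
`Literature.NumberTheory.EllipticCurves.ModularForms.neronLattice_commensurable_of_isIsogenous` (`ℚ`-isogenous curves have
commensurable period lattices), and proves "(2) ⇒ (6)" of Breuil–Conrad–Diamond–Taylor from
them. Everything here is proved:

1. **The lattice bookkeeping for isomorphic models.** For the trivial isogenies — admissible
   changes of variables `C = (u, r, s, t)` over `ℚ` — the fact
   `neronLattice_commensurable_of_isIsogenous` is a theorem: `Λ_{C • W} = u Λ_W` with `u ∈ ℚ^*`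
   (Silverman AEC III.1, Table 3.1: `u⁻¹ω' = ω`; `IsNeronLatticeOf.smul`,
   `IsNeronLatticeOf.lattice_eq_mulLeft_of_smul`), so `a Λ_W ⊆ Λ_{C • W}` for `a` the
   numerator of `u` (`neronLattice_commensurable_smul`). In particular the commensurability
   recorded by `IsNewformOf.exists_maninConstant_ne_zero` does not depend on the model.
2. **Relation to the weaker Eichler–Shimura fact of the tree.**
   `Literature.NumberTheory.EllipticCurves.ModularForms.exists_weierstrassCurve_of_rational_isNewform0` (`NewformGaloisRep.lean`;
   Shimura 1971, Thm. 7.14 with 7.24: for a newform with coefficient field `ℚ`, a curve `W/ℚ`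
   with `a_p(f) = a_p(W)` for the primes `p ∤ N`) follows from `eichlerShimuraConstruction`
   (`exists_weierstrassCurve_of_rational_isNewform0_of`), the only further input being that
   rational Fourier coefficients of a newform are integers (`IsNewform0.exists_intCast_eq_cuspCoeff`:
   algebraic integers by `IsNewform0.isIntegral_coeff_holds`, Shimura Thm. 3.48, and `ℤ` is
   integrally closed).

## References

* J. H. Silverman, *The Arithmetic of Elliptic Curves*, 2nd ed., GTM 106, Springer 2009: III.1,
  Table 3.1 (PDF p. 50). [SilvermanAEC2009]
* A. W. Knapp, *Elliptic Curves*, Princeton 1993: Thm. 11.74, Thm. 12.8. [Knapp1993]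
* G. Shimura, *Introduction to the arithmetic theory of automorphic functions*, 1971:
  Thm. 3.48, Thm. 7.14. [Shimura1971]
-/

noncomputable section

open scoped MatrixGroups ModularForm

open CongruenceSubgroup UpperHalfPlane

namespace Literature.NumberTheory.EllipticCurves.ModularForms

/-! ### The lattice bookkeeping for isomorphic models, proved -/

section SmulCase

/-- **The period lattice of `C • W` is `u Λ`.** Under an admissible change of variables
`C = (u, r, s, t)` over `ℂ`, `c₄(C • W) = u⁻⁴ c₄(W)` and `c₆(C • W) = u⁻⁶ c₆(W)` (Mathlib
`variableChange_c₄/c₆`), while `g₂(uΛ) = u⁻⁴ g₂(Λ)`, `g₃(uΛ) = u⁻⁶ g₃(Λ)`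
(`PeriodPair.g₂_mulLeft`, `g₃_mulLeft`); so if `L` is a Néron-type period pair of `W` then
`uL` is one of `C • W` — the period form of `u⁻¹ω' = ω` (Silverman AEC III.1, Table 3.1).
[cite: SilvermanAEC2009, III.1 Table 3.1 (PDF p. 50)] -/
theorem IsNeronLatticeOf.smul {W : WeierstrassCurve ℂ} {L : PeriodPair}
    (h : IsNeronLatticeOf W L) (C : WeierstrassCurve.VariableChange ℂ) :
    IsNeronLatticeOf (C • W) (L.mulLeft (C.u : ℂ) C.u.ne_zero) := by
  have hinv : ((C.u⁻¹ : ℂˣ) : ℂ) = (C.u : ℂ)⁻¹ := Units.val_inv_eq_inv_val C.u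
  constructor
  · rw [PeriodPair.g₂_mulLeft, WeierstrassCurve.variableChange_c₄, h.1, hinv, inv_pow]
    ring
  · rw [PeriodPair.g₃_mulLeft, WeierstrassCurve.variableChange_c₆, h.2, hinv, inv_pow]
    ring

/-- For a change of variables `C` over `ℚ`, every Néron-type period pair `L'` of `C • W` spans
`u Λ`, where `Λ` is the lattice of any Néron-type period pair `L` of `W` and `u = C.u ∈ ℚ^*`
(`IsNeronLatticeOf.smul` after base change to `ℂ`, Mathlib `map_variableChange`, and the
uniqueness `IsNeronLatticeOf.lattice_eq`). [cite: SilvermanAEC2009, III.1 Table 3.1 (PDF p. 50)] -/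
theorem IsNeronLatticeOf.lattice_eq_mulLeft_of_smul {W : WeierstrassCurve ℚ}
    (C : WeierstrassCurve.VariableChange ℚ) {L L' : PeriodPair}
    (hL : IsNeronLatticeOf (W.baseChange ℂ) L)
    (hL' : IsNeronLatticeOf ((C • W).baseChange ℂ) L') :
    L'.lattice = (L.mulLeft ((C.u : ℚ) : ℂ) (by exact_mod_cast C.u.ne_zero)).lattice := by
  have hmap : (C • W).baseChange ℂ = (C.map (algebraMap ℚ ℂ)) • W.baseChange ℂ := by
    simp only [WeierstrassCurve.baseChange, WeierstrassCurve.map_variableChange]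
  rw [hmap] at hL'
  have h := hL.smul (C.map (algebraMap ℚ ℂ))
  have hu : (((C.map (algebraMap ℚ ℂ)).u : ℂˣ) : ℂ) = ((C.u : ℚ) : ℂ) := by
    simp [WeierstrassCurve.VariableChange.map_u]
  refine (hL'.lattice_eq h).trans ?_
  ext x
  simp only [PeriodPair.mem_mulLeft_lattice, hu]

/-- **`neronLattice_commensurable_of_isIsogenous` for isomorphic models, proved**: for a change
of variables `C = (u, r, s, t)` over `ℚ` and Néron-type period pairs `L` of `W`, `L'` of
`C • W`, one has `a Λ ⊆ Λ'` with `a ∈ ℤ ∖ {0}` the numerator of `u`: `Λ' = u Λ`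
(`IsNeronLatticeOf.lattice_eq_mulLeft_of_smul`) and `a z = den(u) · (u z) ∈ Λ'` for `z ∈ Λ`.
[cite: SilvermanAEC2009, III.1 Table 3.1 (PDF p. 50)] -/
theorem neronLattice_commensurable_smul {W : WeierstrassCurve ℚ}
    (C : WeierstrassCurve.VariableChange ℚ) {L L' : PeriodPair}
    (hL : IsNeronLatticeOf (W.baseChange ℂ) L)
    (hL' : IsNeronLatticeOf ((C • W).baseChange ℂ) L') :
    ∃ a : ℤ, a ≠ 0 ∧ ∀ z ∈ L.lattice, (a : ℂ) * z ∈ L'.lattice := by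
  set u : ℚ := (C.u : ℚ) with hu_def
  have hu : u ≠ 0 := C.u.ne_zero
  refine ⟨u.num, Rat.num_ne_zero.mpr hu, fun z hz ↦ ?_⟩
  rw [IsNeronLatticeOf.lattice_eq_mulLeft_of_smul C hL hL']
  have hmem : (u : ℂ) * z ∈ (L.mulLeft ((u : ℚ) : ℂ) (by exact_mod_cast hu)).lattice := by
    rw [PeriodPair.mem_mulLeft_lattice, ← mul_assoc, inv_mul_cancel₀ (by exact_mod_cast hu),
      one_mul]
    exact hz
  have hnum : ((u.num : ℤ) : ℂ) = (u.den : ℂ) * (u : ℂ) := by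
    have h := Rat.den_mul_eq_num u
    have h' : ((u.den : ℚ) : ℂ) * ((u : ℚ) : ℂ) = ((u.num : ℚ) : ℂ) := by
      rw [← Rat.cast_mul, h]
    simpa using h'.symm
  rw [hnum, mul_assoc]
  exact nsmul_mem hmem u.den |> fun h ↦ by simpa [nsmul_eq_mul] using h

end SmulCase

/-! ### The weaker Eichler–Shimura fact of the tree -/

section Bridge

variable {N : ℕ} [NeZero N]

/-- **Rational Fourier coefficients of a newform are integers**: if `f ∈ S_k(Γ₀(N))` is a
newform with coefficient field `ℚ` then every `aₙ(f)` is (the image of) an integer — `aₙ(f)` is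
rational (`exists_ratCast_eq_coeff_of_coeffField_eq_bot`) and an algebraic integer
(`IsNewform0.isIntegral_coeff_holds`, Shimura 1971, Thm. 3.48), and `ℤ` is integrally closed
in `ℚ`. [cite: Shimura1971, Thm. 3.48] -/
theorem IsNewform0.exists_intCast_eq_cuspCoeff {k : ℤ} {f : CuspForm (Gamma0 N) k}
    (hf : IsNewform0 f) (hQ : coeffField f = ⊥) (n : ℕ) : ∃ a : ℤ, cuspCoeff f n = a := by
  obtain ⟨q, hq⟩ := exists_ratCast_eq_coeff_of_coeffField_eq_bot hQ n
  have hint : IsIntegral ℤ ((qExpansion 1 ⇑f).coeff n) := IsNewform0.isIntegral_coeff_holds hf n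
  rw [← hq] at hint
  have hint' : IsIntegral ℤ ((algebraMap ℚ ℂ).toIntAlgHom q) := by
    simpa only [RingHom.toIntAlgHom_apply, eq_ratCast] using hint
  have hq' : IsIntegral ℤ q :=
    (isIntegral_algHom_iff (algebraMap ℚ ℂ).toIntAlgHom (algebraMap ℚ ℂ).injective).mp hint'
  obtain ⟨a, ha⟩ := IsIntegrallyClosed.isIntegral_iff.mp hq'
  refine ⟨a, ?_⟩
  rw [cuspCoeff, ← hq, ← ha]
  simp

/-- **The weaker Eichler–Shimura fact of `NewformGaloisRep.lean` from
`eichlerShimuraConstruction`**: for a newform `f ∈ S₂(Γ₀(N))` with coefficient field `ℚ` the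
coefficients are integers (`IsNewform0.exists_intCast_eq_cuspCoeff`), so the Eichler–Shimura
curve `W/ℚ` of `eichlerShimuraConstruction` has `aₙ(f) = aₙ(W)` for all `n`, in particular
`a_p(f) = a_p(W)` for the primes `p ∤ N`. [cite: Knapp1993, Thm. 11.74 and Thm. 12.8] -/
theorem exists_weierstrassCurve_of_rational_isNewform0_of (hES : eichlerShimuraConstruction) :
    exists_weierstrassCurve_of_rational_isNewform0 (N := N) := by
  intro f hf hQ
  obtain ⟨W, hW, hWf, -⟩ := hES hf (hf.exists_intCast_eq_cuspCoeff hQ)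
  exact ⟨W, hW, fun p _ _ ↦ hWf.2 p⟩

end Bridge

end Literature.NumberTheory.EllipticCurves.ModularForms

end
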